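import Summits.CriticalPhenomena.PercolationContinuityZ3.Theorems.Transplant.Slab111HubT00Tabs
import Summits.CriticalPhenomena.PercolationContinuityZ3.Theorems.Transplant.Slab111HubT01Tabs
import Summits.CriticalPhenomena.PercolationContinuityZ3.Theorems.Transplant.Slab111HubT02Tabs
import Summits.CriticalPhenomena.PercolationContinuityZ3.Theorems.Transplant.Slab111HubT03Tabs
import Summits.CriticalPhenomena.PercolationContinuityZ3.Theorems.Transplant.Slab111HubT11Tabs
import Summits.CriticalPhenomena.PercolationContinuityZ3.Theorems.Transplant.Slab111HubT12Tabs
import Summits.CriticalPhenomena.PercolationContinuityZ3.Theorems.Transplant.Slab111HubT13Tabs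
import Summits.CriticalPhenomena.PercolationContinuityZ3.Theorems.Transplant.Slab111HubS00Tabs
import Summits.CriticalPhenomena.PercolationContinuityZ3.Theorems.Transplant.Slab111HubS01Tabs
import Summits.CriticalPhenomena.PercolationContinuityZ3.Theorems.Transplant.Slab111HubS02Tabs
import Summits.CriticalPhenomena.PercolationContinuityZ3.Theorems.Transplant.Slab111HubS03Tabs
import Summits.CriticalPhenomena.PercolationContinuityZ3.Theorems.Transplant.Slab111HubS11Tabs
import Summits.CriticalPhenomena.PercolationContinuityZ3.Theorems.Transplant.Slab111HubS12Tabs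
import Summits.CriticalPhenomena.PercolationContinuityZ3.Theorems.Transplant.Slab111HubS13Tabs
import Summits.CriticalPhenomena.PercolationContinuityZ3.Theorems.Transplant.Slab111HubU19Tabs
import Summits.CriticalPhenomena.PercolationContinuityZ3.Theorems.Transplant.HexShadowVLinkageNode
import HarnessLib

/-!
# The HUB ROUTING of the `(111)`-films, FINAL: `ShapedLinkage 3 (Slab111.hexShadow k)` for `k ≥ 51`, and the `(111)`-film node independently of p205010

builds on p205010 (kernel theorem, internal audit signed; external expert review pending) — NOT used in this file or anywhere in this chain:
this is the p205010-INDEPENDENT certification of `Slab111OwnCriticalContinuity k` (the by-name node is also closed via p205010 in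
«Slab111OwnCriticalContinuityHolds»).  Lane `prim-bschramm`, seat `prim-bschramm-p2` (gen 36; class C1b; memo `HOME/bschramm/P2-LATTICES.md`
§130–133); helper file (`--supports stmt-CriticalPhenomena-4575 --as helper`).
**`shapedLinkage_three`**: the node «HexShadowVRouteData».`ShapedLinkage 3` of the `(111)`-film `F_k`, `k ≥ 51`, by block type: both directions
unclipped inside radius 2 → «Slab111HubU19Tabs».`linkage_U19'`; `t_R ≤ 1` → the shapes `T t_R t_D`; `s_R ≤ 1` → the shapes `S s_R s_D`
(«Slab111HubShapeLink4».`linkage_of_shape4` with kernel-checked dispatcher tables).  **`slab111OwnCriticalContinuity_of_hub`**: with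
«HexShadowVLinkageNode».`slab111OwnCriticalContinuity_of_shapedLinkage`, the film of thickness `k ≥ 51` dies at its own critical point.
[cite: DuminilCopinSidoraviciusTassion2016, §2.3 (proof of Fact 2: the three disjoint paths γ_u, γ_v, γ_w in B_R(z))]
[cite: BenjaminiSchramm1996, Conj. 4 / Question 3]
-/

noncomputable section

namespace Summit.CriticalPhenomena.PercolationContinuityZ3.Theorems.Transplant

open Literature.Probability.Percolation Literature.Probability.LatticeModels SimpleGraph

/-- **SHAPED LOCAL LINKAGE OF THE `(111)`-FILMS, surgery radius `3`, every thickness `k ≥ 51`.** [cite: DuminilCopinSidoraviciusTassion2016, §2.3] -/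
theorem Slab111.shapedLinkage_three {k : ℕ} (hk : 51 ≤ k) : (Slab111.hexShadow k).ShapedLinkage 3 := by
  intro z tR tD sR sD htD hsD hone
  by_cases hU : 2 ≤ tR ∧ 2 ≤ sR
  · exact Slab111.linkage_U19' hk z hU.1 hU.2 htD hsD
  rcases hone with h3 | h3
  · -- `3 ≤ t_R`, hence `s_R ≤ 1`: the S-shapes
    have hs : sR = 0 ∨ sR = 1 := by omega
    rcases hs with rfl | rfl
    · rcases Nat.lt_or_ge sD 3 with hlt | hge
      · interval_cases sD
        · exact Slab111.linkage_S00 hk z h3 htD rfl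
        · exact Slab111.linkage_S01 hk z h3 htD rfl
        · exact Slab111.linkage_S02 hk z h3 htD rfl
      · exact Slab111.linkage_S03 hk z h3 htD hge
    · rcases Nat.lt_or_ge sD 3 with hlt | hge
      · interval_cases sD
        · exact Slab111.linkage_S11 hk z h3 htD rfl
        · exact Slab111.linkage_S12 hk z h3 htD rfl
      · exact Slab111.linkage_S13 hk z h3 htD hge
  · -- `3 ≤ s_R`, hence `t_R ≤ 1`: the T-shapes
    have ht : tR = 0 ∨ tR = 1 := by omega
    rcases ht with rfl | rfl
    · rcases Nat.lt_or_ge tD 3 with hlt | hge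
      · interval_cases tD
        · exact Slab111.linkage_T00 hk z rfl h3 hsD
        · exact Slab111.linkage_T01 hk z rfl h3 hsD
        · exact Slab111.linkage_T02 hk z rfl h3 hsD
      · exact Slab111.linkage_T03 hk z hge h3 hsD
    · rcases Nat.lt_or_ge tD 3 with hlt | hge
      · interval_cases tD
        · exact Slab111.linkage_T11 hk z rfl h3 hsD
        · exact Slab111.linkage_T12 hk z rfl h3 hsD
      · exact Slab111.linkage_T13 hk z hge h3 hsD

/-- **THE `(111)`-FILM OF EVERY THICKNESS `k ≥ 51` DIES AT ITS OWN CRITICAL POINT — independently of p205010** (hexagonal-shadow transplant of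
[DST16] with shaped local linkage certified by kernel-checked hub-routing tables). [cite: DuminilCopinSidoraviciusTassion2016, Thm. 1, §2.3]
[cite: BenjaminiSchramm1996, Conj. 4 / Question 3] -/
theorem slab111OwnCriticalContinuity_of_hub {k : ℕ} (hk : 51 ≤ k) : Slab111OwnCriticalContinuity k :=
  slab111OwnCriticalContinuity_of_shapedLinkage (by omega) (Slab111.shapedLinkage_three hk)

end Summit.CriticalPhenomena.PercolationContinuityZ3.Theorems.Transplant

end
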